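import Literature.Analysis.FluidPDE.HardSphereTorusMeasure
import Literature.MathematicalPhysics.KineticTheory.HardSphereEuler
import HarnessLib

/-!
# `JParityClosure.CollisionTightness` (stmt-AtomisticToContinuum-13085), rung 0, step 1:
# the volume swept by a moving contact sphere in time `h` is `O(ε² h |u|)`

Helper file (`--supports stmt-AtomisticToContinuum-13085`).  Two sphere centres at minimal-image
relative position `r` (`‖r‖ ≥ ε`, no overlap) and relative velocity `u` come into contact during
`[0, h]` under free flight iff `‖r + s u‖ = ε` for some `s ∈ [0, h]`.  This file bounds the
Lebesgue measure of the set of such `r` LINEARLY in `h` (no additive `O(ε³)` term — this is what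
makes the window bound of the mean collision number exact in the window length).  In the
coordinates `λ = ⟪r, û⟫` along `û = u/‖u‖` and `p = r − λ û` across, the contact condition
forces `‖p‖ ≤ ε` and `λ ∈ [−a − h‖u‖, −a] ∪ {a}`, `a = √(ε² − ‖p‖²)` (the *swept tube*;
`mem_tube_of_contact`, by completing the square `‖r + s u‖² = ‖p‖² + (λ + s‖u‖)²`,
`norm_add_smul_sq`); every fibre of the tube along `u` has length `h‖u‖` and its base lies in
a square of side `2ε`, so after rotating `û` to a coordinate axis (a reflection,
`Submodule.reflection_sub`, which preserves Lebesgue measure) Fubini gives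
`vol ≤ (2ε)² h ‖u‖` (`volume_tubeProdSet_le`, `volume_tube_le`).  The tube is jointly measurable
in `(r, u)` (`measurableSet_tube_prod`); everything is packaged for the consumers as
`exists_sweptTube`.  No definition is introduced (the sets are written out).

References: C. Cercignani, R. Illner, M. Pulvirenti, *The Mathematical Theory of Dilute Gases*
(1994), App. 4.A (collision cylinder `dx = ε^{d-1}|v·n| dσ dτ`); N. Chernov, J. Stat. Phys. 88
(1997) 1–29 (mean free path of billiards).
-/

noncomputable section

open MeasureTheory Set Filter Topology
open scoped ENNReal InnerProductSpace

namespace Summit.AtomisticToContinuum.HydrodynamicLimit.Theorems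

open Literature.Analysis.FluidPDE Literature.MathematicalPhysics.KineticTheory

/-! ### Completing the square along the relative velocity -/

/-- `‖û‖ = 1` for the unit vector `û = ‖u‖⁻¹ u` of `u ≠ 0`. [folklore] -/
theorem norm_inv_norm_smul {u : V3} (hu : u ≠ 0) : ‖(‖u‖⁻¹ • u : V3)‖ = 1 := by
  rw [norm_smul, norm_inv, norm_norm, inv_mul_cancel₀ (norm_ne_zero_iff.2 hu)]

/-- **Completing the square along `u`**: with `û = ‖u‖⁻¹ u`, `λ = ⟪r, û⟫`, `p = r − λ û`,
`‖r + s u‖² = ‖p‖² + (λ + s‖u‖)²`. [folklore] -/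
theorem norm_add_smul_sq {u : V3} (hu : u ≠ 0) (r : V3) (s : ℝ) :
    ‖r + s • u‖ ^ 2 =
      ‖r - ⟪r, ‖u‖⁻¹ • u⟫_ℝ • (‖u‖⁻¹ • u)‖ ^ 2 + (⟪r, ‖u‖⁻¹ • u⟫_ℝ + s * ‖u‖) ^ 2 := by
  set e : V3 := ‖u‖⁻¹ • u with he
  have he1 : ‖e‖ = 1 := norm_inv_norm_smul hu
  have hue : ‖u‖ • e = u := by
    rw [he, smul_smul, mul_inv_cancel₀ (norm_ne_zero_iff.2 hu), one_smul]
  have hperp : ⟪r - ⟪r, e⟫_ℝ • e, e⟫_ℝ = 0 := by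
    rw [inner_sub_left, inner_smul_left, real_inner_self_eq_norm_sq, he1]
    simp
  have hdec : r + s • u = (r - ⟪r, e⟫_ℝ • e) + (⟪r, e⟫_ℝ + s * ‖u‖) • e := by
    rw [add_smul, mul_smul, hue]
    abel
  have hgen : ∀ (p : V3) (t : ℝ), ⟪p, e⟫_ℝ = 0 → ‖p + t • e‖ ^ 2 = ‖p‖ ^ 2 + t ^ 2 := by
    intro p t hpt
    rw [norm_add_sq_real, inner_smul_right, hpt, mul_zero, mul_zero, add_zero, norm_smul, he1,
      mul_one, Real.norm_eq_abs, sq_abs]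
  rw [hdec, hgen _ _ hperp]

/-- **Contact within `[0, h]` puts `r` in the swept tube**: if `‖r‖ ≥ ε` and `‖r + s u‖ = ε` for
some `s ∈ [0, h]`, then `‖p‖ ≤ ε` and `λ ∈ [−a − h‖u‖, −a] ∪ {a}`, `a = √(ε² − ‖p‖²)`
(`û = ‖u‖⁻¹ u`, `λ = ⟪r, û⟫`, `p = r − λ û`; for `u = 0` this reads `‖r‖ = ε`). [folklore] -/
theorem mem_tube_of_contact {ε h : ℝ} (hε : 0 ≤ ε) {u r : V3} (hr : ε ≤ ‖r‖) {s : ℝ}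
    (hs : s ∈ Icc 0 h) (hc : ‖r + s • u‖ = ε) :
    ‖r - ⟪r, ‖u‖⁻¹ • u⟫_ℝ • (‖u‖⁻¹ • u)‖ ≤ ε ∧
      (⟪r, ‖u‖⁻¹ • u⟫_ℝ ∈
          Icc (-Real.sqrt (ε ^ 2 - ‖r - ⟪r, ‖u‖⁻¹ • u⟫_ℝ • (‖u‖⁻¹ • u)‖ ^ 2) - h * ‖u‖)
            (-Real.sqrt (ε ^ 2 - ‖r - ⟪r, ‖u‖⁻¹ • u⟫_ℝ • (‖u‖⁻¹ • u)‖ ^ 2)) ∨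
        ⟪r, ‖u‖⁻¹ • u⟫_ℝ = Real.sqrt (ε ^ 2 - ‖r - ⟪r, ‖u‖⁻¹ • u⟫_ℝ • (‖u‖⁻¹ • u)‖ ^ 2)) := by
  by_cases hu : u = 0
  · subst hu
    have hr' : ‖r‖ = ε := by
      have : ‖r + s • (0 : V3)‖ = ε := hc
      simpa using this
    simp only [norm_zero, inv_zero, inner_zero_right, smul_zero, sub_zero, mul_zero]
    refine ⟨hr'.le, Or.inr ?_⟩
    rw [hr', sub_self, Real.sqrt_zero]
  set lam := ⟪r, ‖u‖⁻¹ • u⟫_ℝ with hlam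
  set p := r - lam • (‖u‖⁻¹ • u) with hp
  set U := ‖u‖ with hU
  have hU0 : 0 ≤ U := norm_nonneg _
  have key : ‖p‖ ^ 2 + (lam + s * U) ^ 2 = ε ^ 2 := by
    rw [← norm_add_smul_sq hu r s, hc]
  have key0 : ε ^ 2 ≤ ‖p‖ ^ 2 + lam ^ 2 := by
    have h0 := norm_add_smul_sq hu r 0
    simp only [zero_smul, add_zero, zero_mul] at h0
    rw [← h0]
    exact pow_le_pow_left₀ hε hr 2
  have hp2 : ‖p‖ ^ 2 ≤ ε ^ 2 := by nlinarith [sq_nonneg (lam + s * U)]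
  have hpε : ‖p‖ ≤ ε := (pow_le_pow_iff_left₀ (norm_nonneg _) hε two_ne_zero).1 hp2
  set a := Real.sqrt (ε ^ 2 - ‖p‖ ^ 2) with ha
  have ha0 : 0 ≤ a := Real.sqrt_nonneg _
  have ha2 : a ^ 2 = ε ^ 2 - ‖p‖ ^ 2 := Real.sq_sqrt (by linarith)
  have hsq : (lam + s * U) ^ 2 = a ^ 2 := by linarith
  have habs : |lam + s * U| = a := by
    rw [← Real.sqrt_sq_eq_abs, hsq, Real.sqrt_sq ha0]
  have hlam2 : a ^ 2 ≤ lam ^ 2 := by linarith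
  have hsU : 0 ≤ s * U := mul_nonneg hs.1 hU0
  have hsU' : s * U ≤ h * U := mul_le_mul_of_nonneg_right hs.2 hU0
  refine ⟨hpε, ?_⟩
  rcases (abs_eq ha0).1 habs with h1 | h1
  · -- `λ + sU = a`: then `λ ≤ a`, and `|λ| ≥ a` forces `λ = a` or `λ ≤ -a`
    have hle : lam ≤ a := by linarith
    by_cases h2 : a ≤ lam
    · exact Or.inr (le_antisymm hle h2)
    · left
      have h2' : lam < a := lt_of_not_ge h2
      have h3 : lam ≤ -a := by
        by_contra h4
        have h4' : -a < lam := lt_of_not_ge h4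
        nlinarith
      exact ⟨by linarith, h3⟩
  · -- `λ + sU = -a`
    left
    exact ⟨by linarith, by linarith⟩

/-! ### The volume of the tube in coordinates adapted to `u` -/

/-- **The tube in product coordinates has volume at most `(2ε)² h U`.** In coordinates
`(λ, y) ∈ ℝ × ℝ²` the tube is `y₀² + y₁² ≤ ε²`, `λ ∈ [−a − hU, −a] ∪ {a}`, `a = √(ε² − y₀² − y₁²)`:
every fibre along the axis has length `h U` and the base lies in the square of side `2ε`
(Fubini). [folklore] -/
theorem volume_tubeProdSet_le {ε h U : ℝ} (hε : 0 ≤ ε) (hh : 0 ≤ h) (hU : 0 ≤ U) :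
    (volume : Measure (ℝ × (Fin 2 → ℝ)))
        {p | p.2 0 ^ 2 + p.2 1 ^ 2 ≤ ε ^ 2 ∧
          (p.1 ∈ Icc (-Real.sqrt (ε ^ 2 - (p.2 0 ^ 2 + p.2 1 ^ 2)) - h * U)
              (-Real.sqrt (ε ^ 2 - (p.2 0 ^ 2 + p.2 1 ^ 2))) ∨
            p.1 = Real.sqrt (ε ^ 2 - (p.2 0 ^ 2 + p.2 1 ^ 2)))} ≤
      ENNReal.ofReal (4 * ε ^ 2 * h * U) := by
  set T : Set (ℝ × (Fin 2 → ℝ)) := {p | p.2 0 ^ 2 + p.2 1 ^ 2 ≤ ε ^ 2 ∧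
    (p.1 ∈ Icc (-Real.sqrt (ε ^ 2 - (p.2 0 ^ 2 + p.2 1 ^ 2)) - h * U)
        (-Real.sqrt (ε ^ 2 - (p.2 0 ^ 2 + p.2 1 ^ 2))) ∨
      p.1 = Real.sqrt (ε ^ 2 - (p.2 0 ^ 2 + p.2 1 ^ 2)))} with hT
  have hTm : MeasurableSet T := by
    have hq : Measurable fun p : ℝ × (Fin 2 → ℝ) => p.2 0 ^ 2 + p.2 1 ^ 2 := by fun_prop
    have ha : Measurable fun p : ℝ × (Fin 2 → ℝ) =>
        Real.sqrt (ε ^ 2 - (p.2 0 ^ 2 + p.2 1 ^ 2)) := by fun_prop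
    refine (measurableSet_le hq measurable_const).inter ?_
    exact MeasurableSet.union ((measurableSet_le (by fun_prop) measurable_fst).inter
      (measurableSet_le measurable_fst (by fun_prop))) (measurableSet_eq_fun measurable_fst ha)
  set D : Set (Fin 2 → ℝ) := {y | y 0 ^ 2 + y 1 ^ 2 ≤ ε ^ 2} with hD
  have hDm : MeasurableSet D := measurableSet_le (by fun_prop) measurable_const
  have hvol : (volume : Measure (ℝ × (Fin 2 → ℝ))) = volume.prod volume := rfl
  rw [hvol, Measure.prod_apply_symm hTm]
  -- fibre bound
  have hfib : ∀ y : Fin 2 → ℝ,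
      volume ((fun x : ℝ => (x, y)) ⁻¹' T) ≤ D.indicator (fun _ => ENNReal.ofReal (h * U)) y := by
    intro y
    by_cases hy : y ∈ D
    · rw [indicator_of_mem hy]
      set a := Real.sqrt (ε ^ 2 - (y 0 ^ 2 + y 1 ^ 2)) with ha
      have hsub : (fun x : ℝ => (x, y)) ⁻¹' T ⊆ Icc (-a - h * U) (-a) ∪ {a} := by
        intro x hx
        simp only [mem_preimage, hT, mem_setOf_eq] at hx
        rcases hx.2 with h1 | h1
        · exact Or.inl h1
        · exact Or.inr h1
      calc volume ((fun x : ℝ => (x, y)) ⁻¹' T)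
          ≤ volume (Icc (-a - h * U) (-a) ∪ {a}) := measure_mono hsub
        _ ≤ volume (Icc (-a - h * U) (-a)) + volume ({a} : Set ℝ) := measure_union_le _ _
        _ = ENNReal.ofReal (h * U) := by
            rw [Real.volume_Icc, Real.volume_singleton, add_zero]
            congr 1
            ring
    · rw [indicator_of_notMem hy]
      have hempty : (fun x : ℝ => (x, y)) ⁻¹' T = ∅ := by
        ext x
        simp only [mem_preimage, hT, mem_setOf_eq, mem_empty_iff_false, iff_false, not_and]
        intro hx
        exact absurd hx hy
      rw [hempty, measure_empty]
  -- base bound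
  have hDsub : D ⊆ Icc (fun _ => -ε) (fun _ => ε) := by
    intro y hy
    simp only [hD, mem_setOf_eq] at hy
    have h0 : y 0 ^ 2 ≤ ε ^ 2 := by nlinarith [sq_nonneg (y 1)]
    have h1 : y 1 ^ 2 ≤ ε ^ 2 := by nlinarith [sq_nonneg (y 0)]
    have hab : ∀ t : ℝ, t ^ 2 ≤ ε ^ 2 → -ε ≤ t ∧ t ≤ ε := fun t ht => by
      have : |t| ≤ ε := by
        rw [← Real.sqrt_sq_eq_abs, ← Real.sqrt_sq hε]
        exact Real.sqrt_le_sqrt ht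
      exact abs_le.1 this
    refine ⟨fun i => ?_, fun i => ?_⟩
    · fin_cases i
      · exact (hab _ h0).1
      · exact (hab _ h1).1
    · fin_cases i
      · exact (hab _ h0).2
      · exact (hab _ h1).2
  have hDvol : volume D ≤ ENNReal.ofReal (2 * ε) * ENNReal.ofReal (2 * ε) := by
    calc volume D ≤ volume (Icc (fun _ : Fin 2 => -ε) (fun _ => ε)) := measure_mono hDsub
      _ = ENNReal.ofReal (2 * ε) * ENNReal.ofReal (2 * ε) := by
          rw [Real.volume_Icc_pi, Fin.prod_univ_two]
          congr 1 <;> · congr 1; ring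
  calc ∫⁻ y, volume ((fun x : ℝ => (x, y)) ⁻¹' T)
      ≤ ∫⁻ y, D.indicator (fun _ => ENNReal.ofReal (h * U)) y := lintegral_mono hfib
    _ = ENNReal.ofReal (h * U) * volume D := lintegral_indicator_const hDm _
    _ ≤ ENNReal.ofReal (h * U) * (ENNReal.ofReal (2 * ε) * ENNReal.ofReal (2 * ε)) := by
        gcongr
    _ = ENNReal.ofReal (4 * ε ^ 2 * h * U) := by
        rw [← ENNReal.ofReal_mul (by positivity), ← ENNReal.ofReal_mul (by positivity)]
        congr 1
        ring

/-- The tube in coordinates `x : Fin 3 → ℝ` (axis = coordinate `2`) is measurable. [folklore] -/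
theorem measurableSet_tubeCoordSet (ε h U : ℝ) :
    MeasurableSet {x : Fin 3 → ℝ | x 0 ^ 2 + x 1 ^ 2 ≤ ε ^ 2 ∧
      (x 2 ∈ Icc (-Real.sqrt (ε ^ 2 - (x 0 ^ 2 + x 1 ^ 2)) - h * U)
          (-Real.sqrt (ε ^ 2 - (x 0 ^ 2 + x 1 ^ 2))) ∨
        x 2 = Real.sqrt (ε ^ 2 - (x 0 ^ 2 + x 1 ^ 2)))} := by
  have hq : Measurable fun x : Fin 3 → ℝ => x 0 ^ 2 + x 1 ^ 2 := by fun_prop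
  have ha : Measurable fun x : Fin 3 → ℝ => Real.sqrt (ε ^ 2 - (x 0 ^ 2 + x 1 ^ 2)) := by
    fun_prop
  have h2 : Measurable fun x : Fin 3 → ℝ => x 2 := measurable_pi_apply 2
  refine (measurableSet_le hq measurable_const).inter ?_
  exact MeasurableSet.union ((measurableSet_le (by fun_prop) h2).inter
    (measurableSet_le h2 (by fun_prop))) (measurableSet_eq_fun h2 ha)

/-- **The tube in coordinates `x : Fin 3 → ℝ` has volume at most `4 ε² h U`** (split off the
coordinate `2`, `volume_preserving_piFinSuccAbove`, and use the product bound). [folklore] -/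
theorem volume_tubeCoordSet_le {ε h U : ℝ} (hε : 0 ≤ ε) (hh : 0 ≤ h) (hU : 0 ≤ U) :
    volume {x : Fin 3 → ℝ | x 0 ^ 2 + x 1 ^ 2 ≤ ε ^ 2 ∧
      (x 2 ∈ Icc (-Real.sqrt (ε ^ 2 - (x 0 ^ 2 + x 1 ^ 2)) - h * U)
          (-Real.sqrt (ε ^ 2 - (x 0 ^ 2 + x 1 ^ 2))) ∨
        x 2 = Real.sqrt (ε ^ 2 - (x 0 ^ 2 + x 1 ^ 2)))} ≤ ENNReal.ofReal (4 * ε ^ 2 * h * U) := by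
  set T : Set (ℝ × (Fin 2 → ℝ)) := {p | p.2 0 ^ 2 + p.2 1 ^ 2 ≤ ε ^ 2 ∧
    (p.1 ∈ Icc (-Real.sqrt (ε ^ 2 - (p.2 0 ^ 2 + p.2 1 ^ 2)) - h * U)
        (-Real.sqrt (ε ^ 2 - (p.2 0 ^ 2 + p.2 1 ^ 2))) ∨
      p.1 = Real.sqrt (ε ^ 2 - (p.2 0 ^ 2 + p.2 1 ^ 2)))} with hT
  have hpre : {x : Fin 3 → ℝ | x 0 ^ 2 + x 1 ^ 2 ≤ ε ^ 2 ∧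
      (x 2 ∈ Icc (-Real.sqrt (ε ^ 2 - (x 0 ^ 2 + x 1 ^ 2)) - h * U)
          (-Real.sqrt (ε ^ 2 - (x 0 ^ 2 + x 1 ^ 2))) ∨
        x 2 = Real.sqrt (ε ^ 2 - (x 0 ^ 2 + x 1 ^ 2)))} =
      MeasurableEquiv.piFinSuccAbove (fun _ : Fin 3 => ℝ) 2 ⁻¹' T := by
    ext x
    exact Iff.rfl
  have hTm : NullMeasurableSet T (volume : Measure (ℝ × (Fin 2 → ℝ))) := by
    have h := (measurableSet_tubeCoordSet ε h U)
    rw [hpre] at h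
    exact ((MeasurableEquiv.measurableSet_preimage _).1 h).nullMeasurableSet
  rw [hpre, (volume_preserving_piFinSuccAbove (fun _ : Fin 3 => ℝ) 2).measure_preimage hTm]
  exact volume_tubeProdSet_le hε hh hU

/-! ### Rotating `u` to a coordinate axis: the volume of the swept tube -/

/-- **The swept tube has volume at most `4 ε² h ‖u‖`.** For `u = 0` the tube is the contact sphere
(null); for `u ≠ 0` a reflection taking `û` to the coordinate vector `e₂` (`Submodule.reflection_sub`,
measure preserving) identifies it with the coordinate tube of `volume_tubeCoordSet_le`. [folklore] -/
theorem volume_tube_le {ε h : ℝ} (hε : 0 < ε) (hh : 0 ≤ h) (u : V3) :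
    volume {r : V3 | ‖r - ⟪r, ‖u‖⁻¹ • u⟫_ℝ • (‖u‖⁻¹ • u)‖ ≤ ε ∧
      (⟪r, ‖u‖⁻¹ • u⟫_ℝ ∈
          Icc (-Real.sqrt (ε ^ 2 - ‖r - ⟪r, ‖u‖⁻¹ • u⟫_ℝ • (‖u‖⁻¹ • u)‖ ^ 2) - h * ‖u‖)
            (-Real.sqrt (ε ^ 2 - ‖r - ⟪r, ‖u‖⁻¹ • u⟫_ℝ • (‖u‖⁻¹ • u)‖ ^ 2)) ∨
        ⟪r, ‖u‖⁻¹ • u⟫_ℝ = Real.sqrt (ε ^ 2 - ‖r - ⟪r, ‖u‖⁻¹ • u⟫_ℝ • (‖u‖⁻¹ • u)‖ ^ 2))} ≤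
      ENNReal.ofReal (4 * ε ^ 2 * h * ‖u‖) := by
  by_cases hu : u = 0
  · subst hu
    have hsub : {r : V3 | ‖r - ⟪r, ‖(0 : V3)‖⁻¹ • (0 : V3)⟫_ℝ • (‖(0 : V3)‖⁻¹ • (0 : V3))‖ ≤ ε ∧
        (⟪r, ‖(0 : V3)‖⁻¹ • (0 : V3)⟫_ℝ ∈
            Icc (-Real.sqrt (ε ^ 2 - ‖r - ⟪r, ‖(0 : V3)‖⁻¹ • (0 : V3)⟫_ℝ •
              (‖(0 : V3)‖⁻¹ • (0 : V3))‖ ^ 2) - h * ‖(0 : V3)‖)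
              (-Real.sqrt (ε ^ 2 - ‖r - ⟪r, ‖(0 : V3)‖⁻¹ • (0 : V3)⟫_ℝ •
                (‖(0 : V3)‖⁻¹ • (0 : V3))‖ ^ 2)) ∨
          ⟪r, ‖(0 : V3)‖⁻¹ • (0 : V3)⟫_ℝ =
            Real.sqrt (ε ^ 2 - ‖r - ⟪r, ‖(0 : V3)‖⁻¹ • (0 : V3)⟫_ℝ •
              (‖(0 : V3)‖⁻¹ • (0 : V3))‖ ^ 2))} ⊆ Metric.sphere (0 : V3) ε := by
      intro r hr
      simp only [mem_setOf_eq, norm_zero, inv_zero, inner_zero_right, smul_zero, sub_zero,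
        mul_zero] at hr
      obtain ⟨hp, hax⟩ := hr
      have ha0 : Real.sqrt (ε ^ 2 - ‖r‖ ^ 2) ≤ 0 := by
        rcases hax with h1 | h1
        · linarith [h1.1, h1.2]
        · exact h1.symm.le
      have ha : Real.sqrt (ε ^ 2 - ‖r‖ ^ 2) = 0 := le_antisymm ha0 (Real.sqrt_nonneg _)
      rw [Real.sqrt_eq_zero'] at ha
      have hge : ε ≤ ‖r‖ := by nlinarith [norm_nonneg r]
      rw [mem_sphere_zero_iff_norm]
      exact le_antisymm hp hge
    calc _ ≤ volume (Metric.sphere (0 : V3) ε) := measure_mono hsub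
      _ = 0 := Measure.addHaar_sphere_of_ne_zero _ _ hε.ne'
      _ ≤ _ := bot_le
  -- `u ≠ 0`: rotate `û` to `e₂`
  set e : V3 := ‖u‖⁻¹ • u with he
  have he1 : ‖e‖ = 1 := norm_inv_norm_smul hu
  set e₂ : V3 := EuclideanSpace.single (2 : Fin 3) (1 : ℝ) with he₂
  have he₂1 : ‖e₂‖ = 1 := by
    rw [he₂, show (EuclideanSpace.single (2 : Fin 3) (1 : ℝ) : V3) =
      PiLp.single 2 (2 : Fin 3) (1 : ℝ) from rfl, PiLp.norm_single, norm_one]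
  have he₂0 : e₂ 0 = 0 := by simp [he₂]
  have he₂1' : e₂ 1 = 0 := by simp [he₂]
  have he₂2 : e₂ 2 = 1 := by simp [he₂]
  set R : V3 ≃ₗᵢ[ℝ] V3 := Submodule.reflection (ℝ ∙ (e - e₂))ᗮ with hR
  have hRe : R e = e₂ := Submodule.reflection_sub (by rw [he1, he₂1])
  have hax : ∀ r : V3, R r 2 = ⟪r, e⟫_ℝ := by
    intro r
    have h : ⟪R r, e₂⟫_ℝ = ⟪r, e⟫_ℝ := by
      rw [← hRe, LinearIsometryEquiv.inner_map_map]
    rw [← h, he₂, EuclideanSpace.inner_single_right]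
    simp
  have hperp : ∀ r : V3, ‖r - ⟪r, e⟫_ℝ • e‖ ^ 2 = R r 0 ^ 2 + R r 1 ^ 2 := by
    intro r
    have h1 : ‖r - ⟪r, e⟫_ℝ • e‖ = ‖R r - ⟪r, e⟫_ℝ • e₂‖ := by
      rw [← R.norm_map (r - ⟪r, e⟫_ℝ • e), map_sub, LinearIsometryEquiv.map_smul, hRe]
    rw [h1, EuclideanSpace.norm_eq, Real.sq_sqrt (Finset.sum_nonneg fun i _ => by positivity),
      Fin.sum_univ_three]
    simp only [PiLp.sub_apply, PiLp.smul_apply, he₂0, he₂1', he₂2, smul_eq_mul, mul_zero, mul_one,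
      sub_zero, Real.norm_eq_abs, sq_abs, hax, sub_self]
    ring
  set T : Set (Fin 3 → ℝ) := {x | x 0 ^ 2 + x 1 ^ 2 ≤ ε ^ 2 ∧
    (x 2 ∈ Icc (-Real.sqrt (ε ^ 2 - (x 0 ^ 2 + x 1 ^ 2)) - h * ‖u‖)
        (-Real.sqrt (ε ^ 2 - (x 0 ^ 2 + x 1 ^ 2))) ∨
      x 2 = Real.sqrt (ε ^ 2 - (x 0 ^ 2 + x 1 ^ 2)))} with hT
  have hTm : MeasurableSet T := measurableSet_tubeCoordSet ε h ‖u‖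
  have hTm' : MeasurableSet ((WithLp.ofLp : V3 → Fin 3 → ℝ) ⁻¹' T) :=
    hTm.preimage (WithLp.measurable_ofLp 2 _)
  have hsub : {r : V3 | ‖r - ⟪r, ‖u‖⁻¹ • u⟫_ℝ • (‖u‖⁻¹ • u)‖ ≤ ε ∧
      (⟪r, ‖u‖⁻¹ • u⟫_ℝ ∈
          Icc (-Real.sqrt (ε ^ 2 - ‖r - ⟪r, ‖u‖⁻¹ • u⟫_ℝ • (‖u‖⁻¹ • u)‖ ^ 2) - h * ‖u‖)
            (-Real.sqrt (ε ^ 2 - ‖r - ⟪r, ‖u‖⁻¹ • u⟫_ℝ • (‖u‖⁻¹ • u)‖ ^ 2)) ∨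
        ⟪r, ‖u‖⁻¹ • u⟫_ℝ = Real.sqrt (ε ^ 2 - ‖r - ⟪r, ‖u‖⁻¹ • u⟫_ℝ • (‖u‖⁻¹ • u)‖ ^ 2))} ⊆
      R ⁻¹' ((WithLp.ofLp : V3 → Fin 3 → ℝ) ⁻¹' T) := by
    intro r hr
    obtain ⟨hp, hmem⟩ := hr
    change ‖r - ⟪r, e⟫_ℝ • e‖ ≤ ε at hp
    change ⟪r, e⟫_ℝ ∈ Icc (-Real.sqrt (ε ^ 2 - ‖r - ⟪r, e⟫_ℝ • e‖ ^ 2) - h * ‖u‖)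
        (-Real.sqrt (ε ^ 2 - ‖r - ⟪r, e⟫_ℝ • e‖ ^ 2)) ∨
      ⟪r, e⟫_ℝ = Real.sqrt (ε ^ 2 - ‖r - ⟪r, e⟫_ℝ • e‖ ^ 2) at hmem
    have hsq := hperp r
    simp only [mem_preimage, hT, mem_setOf_eq]
    refine ⟨?_, ?_⟩
    · change R r 0 ^ 2 + R r 1 ^ 2 ≤ ε ^ 2
      rw [← hsq]
      exact pow_le_pow_left₀ (norm_nonneg _) hp 2
    · change R r 2 ∈ Icc (-Real.sqrt (ε ^ 2 - (R r 0 ^ 2 + R r 1 ^ 2)) - h * ‖u‖)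
          (-Real.sqrt (ε ^ 2 - (R r 0 ^ 2 + R r 1 ^ 2))) ∨
        R r 2 = Real.sqrt (ε ^ 2 - (R r 0 ^ 2 + R r 1 ^ 2))
      rw [← hsq, hax r]
      exact hmem
  calc _ ≤ volume (R ⁻¹' ((WithLp.ofLp : V3 → Fin 3 → ℝ) ⁻¹' T)) := measure_mono hsub
    _ = volume ((WithLp.ofLp : V3 → Fin 3 → ℝ) ⁻¹' T) :=
        R.measurePreserving.measure_preimage hTm'.nullMeasurableSet
    _ = volume T := (PiLp.volume_preserving_ofLp (Fin 3)).measure_preimage hTm.nullMeasurableSet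
    _ ≤ ENNReal.ofReal (4 * ε ^ 2 * h * ‖u‖) := volume_tubeCoordSet_le hε.le hh (norm_nonneg u)

/-- **The swept tube is jointly measurable** in the relative position and the relative velocity.
[folklore] -/
theorem measurableSet_tube_prod (ε h : ℝ) :
    MeasurableSet {q : V3 × V3 | ‖q.1 - ⟪q.1, ‖q.2‖⁻¹ • q.2⟫_ℝ • (‖q.2‖⁻¹ • q.2)‖ ≤ ε ∧
      (⟪q.1, ‖q.2‖⁻¹ • q.2⟫_ℝ ∈
          Icc (-Real.sqrt (ε ^ 2 - ‖q.1 - ⟪q.1, ‖q.2‖⁻¹ • q.2⟫_ℝ • (‖q.2‖⁻¹ • q.2)‖ ^ 2) -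
              h * ‖q.2‖)
            (-Real.sqrt (ε ^ 2 - ‖q.1 - ⟪q.1, ‖q.2‖⁻¹ • q.2⟫_ℝ • (‖q.2‖⁻¹ • q.2)‖ ^ 2)) ∨
        ⟪q.1, ‖q.2‖⁻¹ • q.2⟫_ℝ =
          Real.sqrt (ε ^ 2 - ‖q.1 - ⟪q.1, ‖q.2‖⁻¹ • q.2⟫_ℝ • (‖q.2‖⁻¹ • q.2)‖ ^ 2))} := by
  have hg : Measurable fun q : V3 × V3 => ⟪q.1, ‖q.2‖⁻¹ • q.2⟫_ℝ := by fun_prop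
  have hf : Measurable fun q : V3 × V3 => ‖q.1 - ⟪q.1, ‖q.2‖⁻¹ • q.2⟫_ℝ • (‖q.2‖⁻¹ • q.2)‖ := by
    fun_prop
  have ha : Measurable fun q : V3 × V3 =>
      Real.sqrt (ε ^ 2 - ‖q.1 - ⟪q.1, ‖q.2‖⁻¹ • q.2⟫_ℝ • (‖q.2‖⁻¹ • q.2)‖ ^ 2) := by fun_prop
  have hn : Measurable fun q : V3 × V3 => h * ‖q.2‖ := by fun_prop
  refine (measurableSet_le hf measurable_const).inter ?_
  exact MeasurableSet.union ((measurableSet_le (ha.neg.sub hn) hg).inter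
    (measurableSet_le hg ha.neg)) (measurableSet_eq_fun hg ha)

/-- **The swept tube, packaged.** For `ε > 0` and `h ≥ 0` there is a family `S u ⊆ ℝ³` of sets,
jointly measurable in `(r, u)`, with `vol (S u) ≤ 4 ε² h ‖u‖`, containing every relative position
`r` with `‖r‖ ≥ ε` from which free relative motion with velocity `u` reaches the contact sphere
`‖·‖ = ε` within time `h`. [folklore] -/
theorem exists_sweptTube {ε h : ℝ} (hε : 0 < ε) (hh : 0 ≤ h) :
    ∃ S : V3 → Set V3, MeasurableSet {q : V3 × V3 | q.1 ∈ S q.2} ∧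
      (∀ u, volume (S u) ≤ ENNReal.ofReal (4 * ε ^ 2 * h * ‖u‖)) ∧
      ∀ (u r : V3) (s : ℝ), ε ≤ ‖r‖ → s ∈ Icc 0 h → ‖r + s • u‖ = ε → r ∈ S u :=
  ⟨fun u => {r : V3 | ‖r - ⟪r, ‖u‖⁻¹ • u⟫_ℝ • (‖u‖⁻¹ • u)‖ ≤ ε ∧
      (⟪r, ‖u‖⁻¹ • u⟫_ℝ ∈
          Icc (-Real.sqrt (ε ^ 2 - ‖r - ⟪r, ‖u‖⁻¹ • u⟫_ℝ • (‖u‖⁻¹ • u)‖ ^ 2) - h * ‖u‖)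
            (-Real.sqrt (ε ^ 2 - ‖r - ⟪r, ‖u‖⁻¹ • u⟫_ℝ • (‖u‖⁻¹ • u)‖ ^ 2)) ∨
        ⟪r, ‖u‖⁻¹ • u⟫_ℝ = Real.sqrt (ε ^ 2 - ‖r - ⟪r, ‖u‖⁻¹ • u⟫_ℝ • (‖u‖⁻¹ • u)‖ ^ 2))},
    measurableSet_tube_prod ε h, volume_tube_le hε hh,
    fun _ _ _ hr hs hc => mem_tube_of_contact hε.le hr hs hc⟩

end Summit.AtomisticToContinuum.HydrodynamicLimit.Theorems

end
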